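import Literature.Analysis.FluidPDE.ForcedOseenPointwiseEnergyBound
import Literature.Analysis.FluidPDE.ClayForceTimeShift
import Literature.Analysis.FluidPDE.ClassicalSolutionGlue
import Literature.Analysis.FluidPDE.TaoForcedEnergyBoundDischarge
import Summits.NavierStokesRegularity.FluidComputer.PalasekTowerTinyHosts
import Summits.NavierStokesRegularity.FluidComputer.PalasekTowerRegisterGlobalBase

/-!
# Negative lane of the crux `EpisodeBase` (stmt-NavierStokesRegularity-19179): an ENERGY FLOOR at `τ₀`
# is necessary for any registered level-1 stage, hence the re-forcing first-episode placeholder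
# `FirstEpisodeR` is FALSE — unconditionally

Cell `ns-blowup`, seat `ns-blowup-ecbridge-4` (g4; GROUP C «BRIDGE SUPPORT», route `PalasekTowerBreakdown`).
LABEL: E–C typing (KERNEL negative-lane theorems, hypothesis-free). WHAT THIS IS NOT: not Navier–Stokes
evidence and NOT a refutation of the crux `EpisodeBaseG` (which is ∃-form over DESIGNED hosts and is
untouched): it (i) proves a NECESSARY CONDITION on every registered level-`1` stage of the register v2.3′ —
its level-`0` readout slice must carry a definite amount of ENERGY once the schedule's ball is small — and
(ii) thereby retires the ∀-over-level-`0`-hosts placeholder `FirstEpisodeR` («every registered level-`0`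
host is pushed to a registered level-`1` stage by SOME admissible window force») of the line
`Cruxes/EpisodeBase/Lines/birth.lean`, as welcomed by the planner's ruling on refuter4's K-ROW K56
(2026-08-26, (r3): a proved `¬FirstEpisodeR` retires the placeholder honestly and costs the ∃-crux
nothing). The predecessor file `FirstEpisodeRFalseOfSmallDataClassicalEngine.lean` (this seat, g3) proved
`¬FirstEpisodeR` MODULO Kato's small-data classical engine `SmallDataClassicalEngine 1` (existence + decay
+ uniqueness); here NO engine is needed: a registered level-`1` stage IS a given bounded classical
finite-energy solution on the first window, and an A-PRIORI pointwise bound along it suffices.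

## The argument

Fix the universal constant `C` of the energy-weighted pointwise bound
`Literature.Analysis.FluidPDE.exists_norm_le_of_energy_forced` and the constant `C_E` of Tao's forced
energy inequality (`tao2011_forced_finiteEnergy_energyBound_holds`). Let `S` be pinned (`Λ = 8`,
`θ = 6/5`) and rigid, of radius `≤ ρ`, and let `s₁` be a registered level-`1` stage of `S` (any margin)
with `‖s₁.u(τ₀)‖₂ ≤ E₀`. On the first window (length `w = τ₁ − τ₀ = 4bβ log N₁/A₀`, rigidity) the
schedule's force is host-small, `‖f‖ ≤ c₄Y₀ ≤ c₁Y₀ = Y₀` (`push_small`), and confined to `B̄(0, ρ)`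
(pins), so `‖f(t)‖₂ ≤ Y₀ (ρ³|B̄₁|)^{1/2} =: G(ρ)`; `s₁` is classical with finite energy and the
register's own ceiling `‖s₁.u‖ ≤ c₂Y₁ = (5/3)Y₁ =: M`; by the energy inequality
`‖s₁.u(t)‖₂ ≤ C_E^{1/2} (E₀ + w G(ρ)) =: E₂` on the window; shifting time to `[0, w]` and re-gauging
the force to its Leray projection (`‖P f(t)‖₂ ≤ ‖f(t)‖₂ ≤ G(ρ)`), the energy-weighted bound gives at
`τ₁`, for every `x`,
`‖s₁.u(τ₁, x)‖ ≤ E₂ w^{-3/4} + C w^{1/8} M^{3/2} E₂^{1/2} + 4 w^{1/4} G(ρ) =: Φ(E₀, ρ)`, continuous with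
`Φ(0, 0) = 0`; for `E₀, ρ ≤ δ` (some `δ > 0` depending only on the register) it is `< Y₁ = c₁Y₁`,
contradicting the level-`1` FLOOR of `s₁`. Hence **`stageOne_energy_floor`**: every registered level-`1`
stage of a pinned rigid schedule of radius `≤ δ` has `‖u(τ₀)‖₂ > δ`. The tiny anchored level-`0` hosts
of `PalasekTowerTinyHosts` (speed `Y₀` on a blob of radius `2a`, `‖U_a‖₂ = O(a^{3/2})`), re-forced by
any admissible push, violate it: **`not_firstEpisodeR`**. (By the tree implication
`FirstEpisode.firstEpisodeR` this is also a second, engine-free route to `¬FirstEpisode` / `¬HeredityAt 0`,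
already landed as `FirstEpisodeHoldRelease.not_firstEpisode` / `.not_heredityAt_zero` by hold-and-release
and therefore not restated here; the re-forcing form is not reachable by hold-and-release since the
prover picks the push.)

READING. The ∀-over-hosts placeholder dies on TINY hosts: the register v2.3′ bounds a level-`0` host only
from above (ceilings) and by scale-free floors met by a blob of speed `Y₀` and arbitrarily small radius,
while the floor-to-floor jump `Y₀ → Y₁` inside the rigid window needs ENERGY at `τ₀` (quantified by
`stageOne_energy_floor`). A repaired placeholder must bound hosts from BELOW (energy / support / `L²`
floor at scale `1/N₀`, or winding-one core loops), or the route keeps the ∃-form `EpisodeBaseG` over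
designed hosts — as recorded by refuter4 K56 and the planner (TARGET §10).

References: J. Leray, Acta Math. 63 (1934) §19–§21 [cite: Leray1934, §19 (3.4)–(3.8)]; T. Kato,
Math. Z. 187 (1984) (2.3)–(2.4′) [cite: Kato1984, (2.3)–(2.4')]; T. Tao, Anal. PDE 6 (2013), Lemma 8.1
[cite: Tao2011, Lemma 8.1 (arXiv Lemma 44)]; S. Palasek, arXiv:2605.13827 §3.3–§4
[cite: Palasek2026ElementaryModel, §3.3].
-/

noncomputable section

namespace Summit.NavierStokesRegularity.EpisodeBaseNegative

open Set MeasureTheory Filter Topology Function Real Metric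
open scoped ENNReal ContDiff NNReal

open Literature.Analysis.FluidPDE
open Summit.NavierStokesRegularity.FluidComputer.PalasekTowerClayBridge

/-! ## §1 Small tools -/

/-- `(∫ ‖h‖²)^{1/2} = ‖h‖₂` (natural-number square inside, real square root outside). [folklore] -/
private theorem rpow_half_lintegral_sq_eq
    (h : EuclideanSpace ℝ (Fin 3) → EuclideanSpace ℝ (Fin 3)) :
    (∫⁻ x, ‖h x‖ₑ ^ 2) ^ (1 / 2 : ℝ) = eLpNorm h 2 volume := by
  rw [eLpNorm_eq_lintegral_rpow_enorm_toReal two_ne_zero ENNReal.ofNat_ne_top, ENNReal.toReal_ofNat]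
  congr 1
  refine lintegral_congr fun x => ?_
  rw [← ENNReal.rpow_natCast]
  norm_num

/-- From `∫ ‖h‖² ≤ B²` (`B ≥ 0`) to `‖h‖₂ ≤ B`. [folklore] -/
private theorem eLpNorm_two_le_of_sq_le {h : EuclideanSpace ℝ (Fin 3) → EuclideanSpace ℝ (Fin 3)}
    {B : ℝ} (hB : 0 ≤ B) (hle : ∫⁻ x, ‖h x‖ₑ ^ 2 ≤ ENNReal.ofReal (B ^ 2)) :
    eLpNorm h 2 volume ≤ ENNReal.ofReal B := by
  rw [← rpow_half_lintegral_sq_eq]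
  calc (∫⁻ x, ‖h x‖ₑ ^ 2) ^ (1 / 2 : ℝ) ≤ (ENNReal.ofReal (B ^ 2)) ^ (1 / 2 : ℝ) :=
        ENNReal.rpow_le_rpow hle (by norm_num)
    _ = ENNReal.ofReal B := by
        rw [ENNReal.ofReal_rpow_of_nonneg (sq_nonneg B) (by norm_num), ← Real.sqrt_eq_rpow,
          Real.sqrt_sq hB]

/-- **`L²` size of a bounded confined field**: `‖h‖ ≤ B` everywhere and `h = 0` off `B̄(0, ρ)` give
`‖h‖₂ ≤ B (ρ³ |B̄₁|)^{1/2}`. [folklore] -/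
private theorem eLpNorm_two_le_of_confined {h : EuclideanSpace ℝ (Fin 3) → EuclideanSpace ℝ (Fin 3)}
    {B ρ : ℝ} (hρ : 0 ≤ ρ) (hbd : ∀ y, ‖h y‖ ≤ B)
    (hconf : ∀ y, ρ < ‖y‖ → h y = 0) :
    eLpNorm h 2 volume ≤ ENNReal.ofReal (B * Real.sqrt (ρ ^ 3 * TinyBlob.unitBallVol)) := by
  have hsupp : support h ⊆ closedBall (0 : EuclideanSpace ℝ (Fin 3)) ρ := by
    intro y hy
    rw [mem_closedBall, dist_zero_right]
    by_contra hlt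
    exact hy (hconf y (not_le.1 hlt))
  rw [← eLpNorm_restrict_eq_of_support_subset hsupp]
  have hb : ∀ᵐ y ∂(volume.restrict (closedBall (0 : EuclideanSpace ℝ (Fin 3)) ρ)), ‖h y‖ ≤ B :=
    Eventually.of_forall fun y => hbd y
  refine (eLpNorm_le_of_ae_bound hb).trans (le_of_eq ?_)
  have hv := TinyBlob.unitBallVol_nonneg
  rw [Measure.restrict_apply_univ, Measure.addHaar_closedBall' volume _ hρ,
    finrank_euclideanSpace, Fintype.card_fin, TinyBlob.volume_closedBall_one,
    ← ENNReal.ofReal_mul (by positivity), ENNReal.toReal_ofNat,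
    ENNReal.ofReal_rpow_of_nonneg (by positivity) (by norm_num),
    ← ENNReal.ofReal_mul (by positivity), Real.sqrt_eq_rpow]
  congr 1
  rw [show ((2 : ℝ)⁻¹) = (1 / 2 : ℝ) by norm_num]
  ring

/-- **The smallness**: the window bound of `exists_norm_le_of_energy_forced` at `ν = 1`, `s = w`, fed with
the force size `G₂ = Y₀ (ρ³ V)^{1/2}` and the energy `E₂ = c_E (E₀ + w G₂)`, is `< Y₁` whenever
`E₀, ρ ∈ [0, δ]`, for some `δ > 0` (it is a continuous function of `(E₀, ρ)` vanishing at the origin).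
[folklore] -/
private theorem exists_small (C cE w M V Y₀ : ℝ) {Y₁ : ℝ} (hY₁ : 0 < Y₁) :
    ∃ δ : ℝ, 0 < δ ∧ ∀ E₀ ρ : ℝ, 0 ≤ E₀ → E₀ ≤ δ → 0 ≤ ρ → ρ ≤ δ → ∀ E₂ G₂ : ℝ,
      G₂ = Y₀ * Real.sqrt (ρ ^ 3 * V) → E₂ = cE * (E₀ + w * G₂) →
      E₂ * (1 * w) ^ (-(3 / 4 : ℝ)) +
          C * (1 : ℝ) ^ (-(7 / 8 : ℝ)) * w ^ (1 / 8 : ℝ) * (M ^ (3 / 2 : ℝ) * E₂ ^ (1 / 2 : ℝ)) +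
          4 * (1 : ℝ) ^ (-(3 / 4 : ℝ)) * w ^ (1 / 4 : ℝ) * G₂ < Y₁ := by
  -- the bound as a function of (energy at `τ₀`, radius)
  set Gf : ℝ × ℝ → ℝ := fun q => Y₀ * Real.sqrt (q.2 ^ 3 * V) with hGf
  set Ef : ℝ × ℝ → ℝ := fun q => cE * (q.1 + w * Gf q) with hEf
  set Φ : ℝ × ℝ → ℝ := fun q =>
    Ef q * (1 * w) ^ (-(3 / 4 : ℝ)) +
      C * (1 : ℝ) ^ (-(7 / 8 : ℝ)) * w ^ (1 / 8 : ℝ) * (M ^ (3 / 2 : ℝ) * Ef q ^ (1 / 2 : ℝ)) +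
      4 * (1 : ℝ) ^ (-(3 / 4 : ℝ)) * w ^ (1 / 4 : ℝ) * Gf q with hΦ
  have hGc : Continuous Gf :=
    continuous_const.mul (Real.continuous_sqrt.comp ((continuous_snd.pow 3).mul continuous_const))
  have hEc : Continuous Ef := continuous_const.mul (continuous_fst.add (continuous_const.mul hGc))
  have hΦc : Continuous Φ := by
    refine ((hEc.mul continuous_const).add ?_).add (continuous_const.mul hGc)
    exact continuous_const.mul (continuous_const.mul (hEc.rpow_const fun _ => Or.inr (by norm_num)))
  have hG0 : Gf (0, 0) = 0 := by simp [hGf]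
  have hE0 : Ef (0, 0) = 0 := by simp [hEf, hG0]
  have hΦ0 : Φ (0, 0) = 0 := by
    simp only [hΦ, hE0, hG0, zero_mul, mul_zero, add_zero,
      Real.zero_rpow (by norm_num : (1 / 2 : ℝ) ≠ 0)]
  have hev : ∀ᶠ q in 𝓝 ((0 : ℝ), (0 : ℝ)), Φ q < Y₁ :=
    (hΦc.tendsto (0, 0)).eventually (Iio_mem_nhds (show Φ (0, 0) < Y₁ by rw [hΦ0]; exact hY₁))
  obtain ⟨ε, hε, hball⟩ := Metric.eventually_nhds_iff.1 hev
  refine ⟨ε / 2, by positivity, fun E₀ ρ hE₀ hE₀δ hρ hρδ E₂ G₂ hG hE => ?_⟩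
  have hdist : dist ((E₀, ρ) : ℝ × ℝ) (0, 0) < ε := by
    rw [Prod.dist_eq, dist_zero_right, dist_zero_right, Real.norm_eq_abs, Real.norm_eq_abs,
      abs_of_nonneg hE₀, abs_of_nonneg hρ]
    exact max_lt (by linarith) (by linarith)
  have h := hball hdist
  have hG' : G₂ = Gf (E₀, ρ) := hG
  have hE' : E₂ = Ef (E₀, ρ) := by rw [hE, hEf, hG']
  rw [hG', hE']
  exact h

/-! ## §2 The energy floor at `τ₀` -/

/-- **ENERGY FLOOR AT `τ₀` — a NECESSARY condition on every registered level-`1` stage (kernel,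
hypothesis-free).** There is `δ > 0`, depending only on the wide register, such that for every pinned
(`Λ = 8`, `θ = 6/5`), rigid schedule `S` on the wide-base rates whose ball has radius `≤ δ`, and ANY
margin set `m`, every stage `s₁` at level `1` (unit viscosity) has level-`0` readout energy
`‖s₁.u(τ₀)‖_{L²} > δ`. Mechanism: on the first window the force is host-small and confined to the tiny
ball (`L²` size `≤ Y₀(δ³|B̄₁|)^{1/2}`), the stage is a bounded (`≤ (5/3)Y₁`, its own ceiling) classical
finite-energy solution, so by the forced energy inequality and the energy-weighted Oseen bound its speed at
`τ₁` is `o(1)` as `δ → 0` — below the level-`1` floor `Y₁`. A quantified form of «the register must bound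
its hosts from BELOW». [cite: Leray1934, §19 (3.4)–(3.8)] [cite: Kato1984, (2.3)–(2.4')]
[cite: Tao2011, Lemma 8.1 (arXiv Lemma 44)] -/
theorem stageOne_energy_floor :
    ∃ δ : ℝ, 0 < δ ∧ ∀ (S : Schedule TowerRates.wide) (m : Margins TowerRates.wide),
      S.Pins 8 (6 / 5) → S.Rigid → S.radius ≤ δ →
      ∀ s₁ : Stage 1 TowerRates.wide S m 1,
        ENNReal.ofReal δ < eLpNorm (s₁.u (S.τ 0)) 2 volume := by
  -- ### universal constants and the register's numbers
  obtain ⟨C, -, hmain⟩ := exists_norm_le_of_energy_forced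
  obtain ⟨CE, hCEtop, hEn⟩ := tao2011_forced_finiteEnergy_energyBound_holds
  set cE : ℝ := Real.sqrt CE.toReal with hcE_def
  have hcE0 : 0 ≤ cE := Real.sqrt_nonneg _
  set w : ℝ := TowerRates.wide.window 0 with hw_def
  have hw0 : 0 < w := TowerRates.wide.window_pos 0
  have hY0 : 0 < TowerRates.wide.Y 0 := TowerRates.Y_pos _ 0
  have hY1 : 0 < TowerRates.wide.Y 1 := TowerRates.Y_pos _ 1
  set M : ℝ := 5 / 3 * TowerRates.wide.Y 1 with hM_def
  have hM0 : 0 < M := by positivity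
  have hV := TinyBlob.unitBallVol_nonneg
  -- ### the smallness constant
  obtain ⟨δ, hδ0, hδ⟩ := exists_small C cE w M TinyBlob.unitBallVol (TowerRates.wide.Y 0) hY1
  refine ⟨δ, hδ0, fun S m hP hR hradδ s₁ => ?_⟩
  by_contra hnot
  have hE₀ : eLpNorm (s₁.u (S.τ 0)) 2 volume ≤ ENNReal.ofReal δ := not_lt.1 hnot
  -- ### window data
  have hτ0 : 0 < S.τ 0 := S.τ_pos 0
  have hτ01 : S.τ 0 < S.τ 1 := S.τ_lt_succ 0
  have hwin : S.τ 1 - S.τ 0 = w := hR.τ_one_sub_τ_zero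
  have hwτ : w + S.τ 0 = S.τ 1 := by linarith
  set ρ : ℝ := max S.radius 0 with hρ_def
  have hρ0 : 0 ≤ ρ := le_max_right _ _
  have hρδ : ρ ≤ δ := max_le hradδ hδ0.le
  have hc₁ : S.c₁ = 1 := hR.c₁_eq
  have hc₄1 : S.c₄ ≤ 1 := hc₁ ▸ S.c₄_le
  -- ### the force on the first window: `‖f‖ ≤ Y₀`, confined to `B̄(0, ρ)`, hence `‖f(t)‖₂ ≤ G(ρ)`
  have hfY : ∀ t ∈ Icc (S.τ 0) (S.τ 1), ∀ x, ‖S.f t x‖ ≤ TowerRates.wide.Y 0 := by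
    intro t ht x
    refine (S.push_small 0 t ht x).trans ?_
    calc S.c₄ * TowerRates.wide.Y 0 ≤ 1 * TowerRates.wide.Y 0 :=
        mul_le_mul_of_nonneg_right hc₄1 hY0.le
      _ = TowerRates.wide.Y 0 := one_mul _
  have hfconf : ∀ t x, ρ < ‖x‖ → S.f t x = 0 := fun t x hx =>
    hP.force_confined t x (lt_of_le_of_lt (le_max_left _ _) hx)
  set Gρ : ℝ := TowerRates.wide.Y 0 * Real.sqrt (ρ ^ 3 * TinyBlob.unitBallVol) with hGρ_def
  have hGρ0 : 0 ≤ Gρ := by positivity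
  have hfL2 : ∀ t ∈ Icc (S.τ 0) (S.τ 1), eLpNorm (S.f t) 2 volume ≤ ENNReal.ofReal Gρ := fun t ht =>
    eLpNorm_two_le_of_confined hρ0 (hfY t ht) (fun y hy => hfconf t y hy)
  -- ### the stage on the first window, shifted to `[0, w]`
  have hcl₁ : IsClassicalNSSolutionOn (Icc 0 (S.τ 1)) 1 S.f s₁.u s₁.p := s₁.classical
  set v : ℝ → EuclideanSpace ℝ (Fin 3) → EuclideanSpace ℝ (Fin 3) := fun t => s₁.u (t + S.τ 0)
    with hv_def
  set q : ℝ → EuclideanSpace ℝ (Fin 3) → ℝ := fun t => s₁.p (t + S.τ 0) with hq_def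
  set f' : ℝ → EuclideanSpace ℝ (Fin 3) → EuclideanSpace ℝ (Fin 3) := fun t => S.f (t + S.τ 0)
    with hf'_def
  have hmemI : ∀ {t : ℝ}, t ∈ Icc 0 w → t + S.τ 0 ∈ Icc 0 (S.τ 1) := fun ht =>
    ⟨by linarith [ht.1], by linarith [ht.2]⟩
  have hmemW : ∀ {t : ℝ}, t ∈ Icc 0 w → t + S.τ 0 ∈ Icc (S.τ 0) (S.τ 1) := fun ht =>
    ⟨by linarith [ht.1], by linarith [ht.2]⟩
  have hcl' : IsClassicalNSSolutionOn (Icc 0 w) 1 f' v q :=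
    (hcl₁.comp_add_right (S.τ 0)).mono (fun t ht => show t + S.τ 0 ∈ Icc 0 (S.τ 1) from hmemI ht)
      (uniqueDiffOn_Icc hw0)
  have hv0 : v 0 = s₁.u (S.τ 0) := by
    show s₁.u (0 + S.τ 0) = _
    rw [zero_add]
  have hvw : v w = s₁.u (S.τ 1) := by
    show s₁.u (w + S.τ 0) = _
    rw [hwτ]
  have hvE : ∃ Cv : ℝ≥0∞, Cv < ⊤ ∧ ∀ t ∈ Icc 0 w, ∫⁻ x, ‖v t x‖ₑ ^ 2 ≤ Cv := by
    obtain ⟨Cv, hCv, hb⟩ := s₁.energy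
    exact ⟨Cv, hCv, fun t ht => hb (t + S.τ 0) (hmemI ht)⟩
  have hvM : ∀ t ∈ Icc 0 w, ∀ x, ‖v t x‖ ≤ M := by
    intro t ht x
    have h := s₁.ceiling 1 le_rfl (t + S.τ 0) (hmemI ht) x
    rw [hR.c₂_eq] at h
    exact h
  -- ### the shifted force: bounded, confined, `L²`-small, Clay class on the slab
  have hf'L2 : ∀ t ∈ Icc 0 w, eLpNorm (f' t) 2 volume ≤ ENNReal.ofReal Gρ := fun t ht =>
    hfL2 (t + S.τ 0) (hmemW ht)
  have hf's : IsSmoothSpaceTimeOn (Icc 0 w) f' :=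
    S.force_smooth.isSmoothSpaceTimeOn_Icc_timeShift hτ0.le w
  have hf'd : HasUniformRapidDecayOn (Icc 0 w) f' :=
    S.force_decay.hasUniformRapidDecayOn_Icc_timeShift S.force_smooth hτ0.le hw0
  -- ### the energy inequality along the window: `‖v(t)‖₂ ≤ E₂`
  have hΛ : ∫⁻ t in Icc 0 w, (∫⁻ x, ‖f' t x‖ₑ ^ 2) ^ (1 / 2 : ℝ) ≤ ENNReal.ofReal (w * Gρ) := by
    calc ∫⁻ t in Icc 0 w, (∫⁻ x, ‖f' t x‖ₑ ^ 2) ^ (1 / 2 : ℝ)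
        ≤ ∫⁻ _t in Icc 0 w, ENNReal.ofReal Gρ :=
          setLIntegral_mono' measurableSet_Icc fun t ht => by
            rw [rpow_half_lintegral_sq_eq]; exact hf'L2 t ht
      _ = ENNReal.ofReal Gρ * volume (Icc 0 w) := setLIntegral_const _ _
      _ = ENNReal.ofReal (w * Gρ) := by
          rw [Real.volume_Icc, sub_zero, ← ENNReal.ofReal_mul hGρ0, mul_comm]
  have hfE : ∫⁻ t in Icc 0 w, (∫⁻ x, ‖f' t x‖ₑ ^ 2) ^ (1 / 2 : ℝ) < ⊤ :=
    hΛ.trans_lt ENNReal.ofReal_lt_top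
  have hEA : ∃ A : ℝ≥0, ∀ t ∈ Icc 0 w, ∫⁻ x, ‖v t x‖ₑ ^ 2 ≤ A := by
    obtain ⟨Cv, hCv, hb⟩ := hvE
    exact ⟨Cv.toNNReal, fun t ht => (hb t ht).trans (ENNReal.coe_toNNReal hCv.ne).ge⟩
  have hEv := (hEn one_pos hw0 hcl' hf's hfE hEA).1
  set E₂ : ℝ := cE * (δ + w * Gρ) with hE₂_def
  have hE₂0 : 0 ≤ E₂ := by positivity
  have hv0L2 : (∫⁻ x, ‖v 0 x‖ₑ ^ 2) ^ (1 / 2 : ℝ) ≤ ENNReal.ofReal δ := by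
    rw [rpow_half_lintegral_sq_eq, hv0]
    exact hE₀
  have hvL2 : ∀ t ∈ Icc 0 w, eLpNorm (v t) 2 volume ≤ ENNReal.ofReal E₂ := by
    intro t ht
    have h1 := hEv t ht
    have h2 : ∫⁻ x, ‖v t x‖ₑ ^ 2 ≤ ENNReal.ofReal (E₂ ^ 2) := by
      refine h1.trans ?_
      calc CE * ((∫⁻ x, ‖v 0 x‖ₑ ^ 2) ^ (1 / 2 : ℝ) +
            ∫⁻ t in Icc 0 w, (∫⁻ x, ‖f' t x‖ₑ ^ 2) ^ (1 / 2 : ℝ)) ^ 2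
          ≤ CE * (ENNReal.ofReal δ + ENNReal.ofReal (w * Gρ)) ^ 2 := by gcongr
        _ = ENNReal.ofReal (E₂ ^ 2) := by
            rw [← ENNReal.ofReal_add hδ0.le (by positivity), ← ENNReal.ofReal_pow (by positivity),
              ← ENNReal.ofReal_toReal hCEtop.ne, ← ENNReal.ofReal_mul ENNReal.toReal_nonneg]
            congr 1
            rw [hE₂_def, mul_pow, Real.sq_sqrt ENNReal.toReal_nonneg]
    exact eLpNorm_two_le_of_sq_le hE₂0 h2
  -- ### re-gauge the force to its Leray projection and apply the energy-weighted bound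
  have hclP := hcl'.to_clayProjForce hw0 hf's hf'd
  obtain ⟨G, -, hG⟩ := exists_norm_clayProjForce_le hw0 hf's hf'd
  have hgPc := continuous_uncurry_clayProjForce hw0 hf's hf'd
  have hgPdiv : ∀ τ ∈ Icc 0 w, IsWeaklyDivFree (clayProjForce hw0 hf's hf'd τ) := fun τ _ =>
    isWeaklyDivFree_clayProjForce hw0 hf's hf'd τ
  have hgPL2 : ∀ τ ∈ Icc 0 w,
      eLpNorm (clayProjForce hw0 hf's hf'd τ) 2 volume ≤ ENNReal.ofReal Gρ := by
    intro τ hτ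
    refine (eLpNorm_two_clayProjForce_le hw0 hf's hf'd τ).trans ?_
    rw [FourierNS.clamp_of_mem hτ]
    exact hf'L2 τ hτ
  have hbound := hmain one_pos hw0 hclP hgPc (fun τ _ y => hG τ y) hgPdiv hGρ0 hgPL2 hvE hM0 hvM
    hE₂0 hvL2 w ⟨hw0, le_rfl⟩
  have hlt := hδ δ ρ hδ0.le le_rfl hρ0 hρδ E₂ Gρ rfl rfl
  -- ### … contradicting the level-1 floor of the stage
  obtain ⟨x, -, hfl⟩ := s₁.floor 1 le_rfl
  rw [hc₁, one_mul] at hfl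
  have key : ‖v w x‖ < TowerRates.wide.Y 1 := (hbound x).trans_lt hlt
  rw [hvw] at key
  linarith

/-! ## §3 The placeholder is false -/

/-- **THE RE-FORCING FIRST-EPISODE PLACEHOLDER IS FALSE (unconditionally).** `FirstEpisodeR` — «for
every pinned rigid quiet schedule and every registered, globally anchored level-`0` host there is an
admissible window push re-forcing the schedule to a registered LEVEL-`1` stage extending the host» —
fails: the tiny anchored host `U_a` (speed `Y₀` on a blob of radius `2a`, `PalasekTowerTinyHosts`) has
`‖U_a‖₂ ≤ Y₀ (8a³|B̄₁|)^{1/2}`; for `a` small both the re-forced schedule's radius `2a` and this energy are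
below the `δ` of `stageOne_energy_floor`, so NO level-`1` stage of ANY re-forcing extends the host. No
existence theory, no small-data engine, no uniqueness is used. [cite: Palasek2026ElementaryModel, §3.3]
[cite: Leray1934, §19 (3.4)–(3.8)] [cite: Kato1984, (2.3)–(2.4')] -/
theorem not_firstEpisodeR : ¬ FirstEpisodeR := by
  intro hF
  obtain ⟨δ, hδ0, hδ⟩ := stageOne_energy_floor
  have hY0 : 0 < TowerRates.wide.Y 0 := TowerRates.Y_pos _ 0
  have hV := TinyBlob.unitBallVol_nonneg
  have hκ₁ := TinyBlob.strainConst_pos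
  -- ### the scale: `a ≤ 5/256`, `a ≤ κ₁/256`, `2a ≤ δ`, `8 a (|B̄₁| + 1) Y₀² ≤ δ²`
  set a : ℝ := min (min (5 / 256) (TinyBlob.strainConst / 256))
    (min (δ / 2) (δ ^ 2 / (8 * (TinyBlob.unitBallVol + 1) * TowerRates.wide.Y 0 ^ 2))) with ha_def
  have ha : 0 < a :=
    lt_min (lt_min (by norm_num) (by positivity)) (lt_min (by positivity) (by positivity))
  have h5 : a ≤ 5 / 256 := (min_le_left _ _).trans (min_le_left _ _)
  have hκ : a ≤ TinyBlob.strainConst / 256 := (min_le_left _ _).trans (min_le_right _ _)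
  have haδ : a ≤ δ / 2 := (min_le_right _ _).trans (min_le_left _ _)
  have haE : a ≤ δ ^ 2 / (8 * (TinyBlob.unitBallVol + 1) * TowerRates.wide.Y 0 ^ 2) :=
    (min_le_right _ _).trans (min_le_right _ _)
  have ha1 : a ≤ 1 := h5.trans (by norm_num)
  -- ### the tiny host and the push handed by `FirstEpisodeR`
  obtain ⟨S, hP, hR, hQ, hrad, s₀, hs₀⟩ := (TinyBlob.levelZeroDataWeak ha h5 hκ).exists_host
  obtain ⟨g, h₁, h₂, h₃, h₄, -, hP', hR', -, s₁, hs₁⟩ := hF S hP hR hQ s₀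
  have hτ0 : 0 < S.τ 0 := S.τ_pos 0
  have hradδ : (S.reforce g h₁ h₂ h₃ h₄).radius ≤ δ := by
    rw [Schedule.reforce_radius, hrad]; linarith
  -- ### the energy floor at `τ₀` …
  have hlt := hδ (S.reforce g h₁ h₂ h₃ h₄) (Margins.routeG TowerRates.wide) hP' hR' hradδ s₁
  -- ### … is violated by the tiny host
  have hu0 : s₁.u (S.τ 0) = TinyBlob.tinyProfile a :=
    ((hs₁ (S.τ 0) ⟨hτ0.le, le_rfl⟩).1).trans hs₀
  have hsmall : TowerRates.wide.Y 0 * Real.sqrt ((2 * a) ^ 3 * TinyBlob.unitBallVol) ≤ δ := by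
    have hx : TowerRates.wide.Y 0 ^ 2 * ((2 * a) ^ 3 * TinyBlob.unitBallVol) ≤ δ ^ 2 := by
      have h3 : a ^ 3 ≤ a :=
        calc a ^ 3 = a * a ^ 2 := by ring
          _ ≤ a * 1 := mul_le_mul_of_nonneg_left (by nlinarith) ha.le
          _ = a := mul_one a
      rw [le_div_iff₀ (by positivity)] at haE
      calc TowerRates.wide.Y 0 ^ 2 * ((2 * a) ^ 3 * TinyBlob.unitBallVol)
          = 8 * a ^ 3 * TinyBlob.unitBallVol * TowerRates.wide.Y 0 ^ 2 := by ring
        _ ≤ 8 * a * (TinyBlob.unitBallVol + 1) * TowerRates.wide.Y 0 ^ 2 := by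
            have hV1 : TinyBlob.unitBallVol ≤ TinyBlob.unitBallVol + 1 := by linarith
            gcongr
        _ = a * (8 * (TinyBlob.unitBallVol + 1) * TowerRates.wide.Y 0 ^ 2) := by ring
        _ ≤ δ ^ 2 := haE
    calc TowerRates.wide.Y 0 * Real.sqrt ((2 * a) ^ 3 * TinyBlob.unitBallVol)
        = Real.sqrt (TowerRates.wide.Y 0 ^ 2 * ((2 * a) ^ 3 * TinyBlob.unitBallVol)) := by
          rw [Real.sqrt_mul (sq_nonneg _), Real.sqrt_sq hY0.le]
      _ ≤ Real.sqrt (δ ^ 2) := Real.sqrt_le_sqrt hx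
      _ = δ := Real.sqrt_sq hδ0.le
  have hle : eLpNorm (s₁.u (S.τ 0)) 2 volume ≤ ENNReal.ofReal δ := by
    rw [hu0]
    refine (eLpNorm_two_le_of_confined (ρ := 2 * a) (by positivity)
      (TinyBlob.norm_tinyProfile_le ha.ne')
      (fun y hy => TinyBlob.tinyProfile_eq_zero_of_norm_gt ha hy)).trans ?_
    exact ENNReal.ofReal_le_ofReal hsmall
  have hlt' : ENNReal.ofReal δ < eLpNorm (s₁.u (S.τ 0)) 2 volume := by
    simpa only [Schedule.reforce_τ] using hlt
  exact absurd hle (not_le.2 hlt')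

end Summit.NavierStokesRegularity.EpisodeBaseNegative

end
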